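import Literature.MathematicalPhysics.QuantumFieldTheory.Balaban1983to89.T4ShellMeasurePlaquette

/-!
# `T4Continuum.ShellMeasureWilsonWords` — scaled words of exponentials: the TWO-POINT INTERPOLATION BOUND and the
# LEVEL-0 CORE MAP (S-i)₀ of the smooth member (γ_loc)
# (cell `pub-balaban`, sub-cell `t4`, spine estimate NE7c (node U5b); lineage t4-ne7c-p1 = PROVER seat P1
# «shell-measure route», generation 25; tree target `Summits/QuantumFields/BalabanUV/T4Continuum/Support/`;
# ADDITIVE — imports the lineage's leaf `T4ShellMeasurePlaquette` (exponential remainders) only and modifies nothing;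
# file 1 of 3: `ShellMeasureWilsonWords` → `ShellMeasureWilsonTrace` → `ShellMeasureWilsonBlock`)

HONEST FRAMING.  Finite four-torus programme, rung (B)+1 only — NOT infinite volume, NOT a mass gap, NOT the Clay
problem, NOT summit progress; (B), `BetaPertHyp`, (B^μ) are not mentioned because nothing here consumes them.  The
cell wall of NE7c — (M1) `T4ShellMeasure.SlotAntiConcentration` FOR BAŁABAN'S INDUCTIVELY DEFINED EFFECTIVE MEASURES —
is NOT PRINTED in [Balaban 1983–89] (GAPS G-ne7cp1-1), asserted by nobody, and NOT moved by this file.  What the three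
files do is INSTANTIATE the two located inputs of the smooth member — (S-i) core map, (S-ii) ray-weight loss (GAPS
G-ne7cp1-21 ∕ -22) — at LEVEL `j = 0` of the induction, where the tested variable of B14 (2.17) is the bare plaquette
field (`U_{0,□}(V) = V`) and the block weight is the sectioned Wilson weight of B12 (0.2): there both objects are
words of exponentials of the chart's generators, and the two inputs become [folklore] inequalities, proved here
WITHOUT any statement about Bałaban's minimisers `U_{j,□}(V)` (B14 (2.16), B11 Prop. 9) or effective actions `A_j`
(B12 Thm 1, B14 (2.23)), which carry the located inputs at the live levels `j ≥ 1` — untouched.  Every declaration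
is [folklore] kernel mathematics, 0 sorry, 0 citations.  HONEST DEPENDENCY (cell): continuum YM on T⁴ ⇐ BetaPertH ∧
nine spine estimates (0/9 proved); BetaPertH ⇐ (D1) ∧ (D4) ∧ CAP+tail; G-an2-4 gates asym, D1 and NE2/3/4.

THE POINTS.
* §2 (I1)/(I2) THE TWO-POINT INTERPOLATION BOUND.  For a word `h(c) = exp(cY₁)⋯exp(cY_ℓ) − 1` of scaled generators
  in a complete normed algebra, `s = Σ‖Y_i‖ ≤ 1`, `0 ≤ c ≤ 1`:  `‖h(c) − c·h(1)‖ ≤ 4·c(1−c)·s²·e^{2s}`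
  (`norm_wordExp_interp_le`).  The defect from the chord vanishes at BOTH ends — it is proportional to the contraction
  depth `1 − c ≈ ρ`, which is what a one-depth core map needs; the second-order remainder `‖h(c) − c·ΣY_i‖ = O(c²s²)`
  alone (the near-linearity of `T4ShellMeasureAnalytic`) is NOT proportional to `1 − c`.  Proof: the exact splitting
  `exp Y = exp(cY)·exp((1−c)Y)`, two `module` identities and the lineage's first/second-order exponential remainders
  (`T4ShellMeasurePlaquette`); no power series, no Cauchy estimate, no inner product.
* §3 (S-i)₀ THE LEVEL-0 CORE MAP (`coreMap_word`, `coreMap_sup`).  If every plaquette word of the classifier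
  `u = max_p ‖hol_p − 1‖` is below `θ` and THE LEVEL-0 SMALLNESS (SM)₀ `4s̄²e^{2s̄} ≤ δθ` holds for the generator
  size `s̄` on the window, then at the depth `c = 1 − ρ/(1−δ)` (`depth_admissible`) every contracted word is below
  `θ(1−ρ)` — UNIFORMLY over the plaquettes, with NO transversal/degenerate split (dead end D10 does not arise at one
  depth: a plaquette with a small linear part simply stays in the core).  (SM)₀ is the level-0 form of (SM) of GAPS
  G-ne7cp1-9: `s̄ ≈ 4x₀`, `x₀` the axial reach of the window, against the threshold `θ₀ = ε₀`.

WHAT THIS DOES NOT DO.  No instance at a live level `j ≥ 1` (there the words are words in the minimiser's bond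
variables `𝓗(B)` of B11 Prop. 9 — the binders of `T4ShellMeasurePlaquette` — not in the chart's generators); level 0
is in NE7c's live window only for `K ≤ N₁` (W1); (Det), (FI-sat), (LR), (MR), (W1), the (F∞)-rate keep their status.
NE7c NOT proved; 0/9 spine.
-/

noncomputable section

open NormedSpace Set

namespace Summit.QuantumFields.BalabanUV.T4Continuum.ShellMeasureWilsonWords

open Literature.MathematicalPhysics.QuantumFieldTheory.Balaban1983to89
open T4ShellMeasurePlaquette (norm_exp_sub_one_le norm_exp_sub_one_sub_le norm_listProd_exp_sub_one_le expTail₂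
  expTail₂_le_sq)

/-! ## §1 Real bookkeeping -/

section RealLemmas

/-- the two elementary exponential bounds used throughout, for `x ≥ 0`: `eˣ − 1 ≤ x·eˣ` (from `1 − x ≤ e^{−x}`), and
`eˣ − 1 ≤ 3x` when moreover `x ≤ 1` (`e < 3`). [folklore] -/
theorem exp_sub_one_le_pair {x : ℝ} (hx : 0 ≤ x) :
    Real.exp x - 1 ≤ x * Real.exp x ∧ (x ≤ 1 → Real.exp x - 1 ≤ 3 * x) := by
  have h := Real.add_one_le_exp (-x)
  have hx1 : Real.exp x * Real.exp (-x) = 1 := by rw [← Real.exp_add, add_neg_cancel, Real.exp_zero]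
  have h2 := mul_le_mul_of_nonneg_left h (Real.exp_pos x).le
  rw [hx1] at h2
  have hA : Real.exp x - 1 ≤ x * Real.exp x := by linarith
  refine ⟨hA, fun h1 => hA.trans ?_⟩
  have h3 : Real.exp x ≤ Real.exp 1 := Real.exp_le_exp.2 h1
  nlinarith [Real.exp_one_lt_d9]

end RealLemmas

/-! ## §2 The two-point interpolation bound for one exponential and for a word of exponentials -/

section Interp

variable {A : Type*} [NormedRing A] [NormedAlgebra ℂ A] [CompleteSpace A]

omit [CompleteSpace A] in
/-- `‖(r : ℂ) • X‖ = r‖X‖` for `r ≥ 0`. [folklore] -/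
theorem norm_real_smul {r : ℝ} (hr : 0 ≤ r) (X : A) : ‖(r : ℂ) • X‖ = r * ‖X‖ := by
  rw [norm_smul, Complex.norm_real, Real.norm_of_nonneg hr]

/-- SPLITTING ONE EXPONENTIAL: `exp Y = exp(aY)·exp(bY)` for real `a + b = 1` (the two exponents commute). [folklore] -/
theorem exp_eq_exp_smul_mul_exp_smul (Y : A) {a b : ℝ} (hab : a + b = 1) :
    exp Y = exp ((a : ℂ) • Y) * exp ((b : ℂ) • Y) := by
  letI : NormedAlgebra ℚ A := NormedAlgebra.restrictScalars ℚ ℂ A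
  rw [← exp_add_of_commute (((Commute.refl Y).smul_right _).smul_left _), ← add_smul]
  have : ((a : ℂ) + (b : ℂ)) = 1 := by exact_mod_cast hab
  rw [this, one_smul]

/-- `‖exp(cY) − 1‖ ≤ e^{c‖Y‖} − 1 ≤ c‖Y‖·e^{c‖Y‖}` for `c ≥ 0`. [folklore] -/
theorem norm_exp_smul_sub_one_le (Y : A) {c : ℝ} (hc0 : 0 ≤ c) :
    ‖exp ((c : ℂ) • Y) - 1‖ ≤ c * ‖Y‖ * Real.exp (c * ‖Y‖) := by
  have h := norm_exp_sub_one_le ((c : ℂ) • Y)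
  rw [norm_real_smul hc0] at h
  exact h.trans (exp_sub_one_le_pair (mul_nonneg hc0 (norm_nonneg _))).1

/-- the second-order remainder of a scaled exponential: `‖exp(cY) − 1 − cY‖ ≤ (c‖Y‖)²` for `0 ≤ c`, `c‖Y‖ ≤ 1`.
[folklore] -/
theorem norm_exp_smul_sub_one_sub_le (Y : A) {c : ℝ} (hc0 : 0 ≤ c) (hc : c * ‖Y‖ ≤ 1) :
    ‖exp ((c : ℂ) • Y) - 1 - (c : ℂ) • Y‖ ≤ (c * ‖Y‖) ^ 2 := by
  have h := norm_exp_sub_one_sub_le ((c : ℂ) • Y)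
  rw [norm_real_smul hc0] at h
  have ht : |c * ‖Y‖| ≤ 1 := by rw [abs_of_nonneg (mul_nonneg hc0 (norm_nonneg _))]; exact hc
  have h2 := expTail₂_le_sq ht
  unfold expTail₂ at h2
  exact h.trans h2

/-- **(I1) THE TWO-POINT INTERPOLATION BOUND FOR ONE EXPONENTIAL.**  For `‖Y‖ ≤ 1` and `0 ≤ c ≤ 1`:
`‖exp(cY) − 1 − c·(exp Y − 1)‖ ≤ 4·c(1−c)·‖Y‖²` — the defect of `h(c) = exp(cY) − 1` from the chord `c·h(1)` vanishes
at BOTH ends `c = 0, 1`.  Proof: with `E = exp(cY)`, `E′ = exp((1−c)Y)`, `exp Y = EE′`, the exact identity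
`E − 1 − c(EE′ − 1) = (1−c)(E − 1 − cY) − c[(E − 1)(E′ − 1) + (E′ − 1 − (1−c)Y)]` and the first/second-order
exponential remainders; no power series is manipulated. [folklore] -/
theorem norm_exp_interp_le (Y : A) {c : ℝ} (hc0 : 0 ≤ c) (hc1 : c ≤ 1) (hY : ‖Y‖ ≤ 1) :
    ‖exp ((c : ℂ) • Y) - 1 - (c : ℂ) • (exp Y - 1)‖ ≤ 4 * (c * (1 - c)) * ‖Y‖ ^ 2 := by
  set t := ‖Y‖ with ht
  have ht0 : 0 ≤ t := norm_nonneg _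
  have h1c : 0 ≤ 1 - c := by linarith
  set E := exp ((c : ℂ) • Y) with hE
  set E' := exp (((1 - c : ℝ) : ℂ) • Y) with hE'
  have hEE' : exp Y = E * E' := exp_eq_exp_smul_mul_exp_smul Y (by ring : c + (1 - c) = 1)
  have key : E - 1 - (c : ℂ) • (exp Y - 1) =
      ((1 - c : ℝ) : ℂ) • (E - 1 - (c : ℂ) • Y) -
        (c : ℂ) • ((E - 1) * (E' - 1) + (E' - 1 - ((1 - c : ℝ) : ℂ) • Y)) := by
    rw [hEE']
    push_cast
    simp only [mul_sub, sub_mul, mul_one, one_mul, smul_sub, smul_add]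
    module
  have hct : c * t ≤ 1 := by nlinarith
  have h1ct : (1 - c) * t ≤ 1 := by nlinarith
  have hA : ‖E - 1 - (c : ℂ) • Y‖ ≤ (c * t) ^ 2 := norm_exp_smul_sub_one_sub_le Y hc0 hct
  have hB : ‖E' - 1 - ((1 - c : ℝ) : ℂ) • Y‖ ≤ ((1 - c) * t) ^ 2 := norm_exp_smul_sub_one_sub_le Y h1c h1ct
  have hC : ‖E - 1‖ ≤ c * t * Real.exp (c * t) := norm_exp_smul_sub_one_le Y hc0
  have hD : ‖E' - 1‖ ≤ (1 - c) * t * Real.exp ((1 - c) * t) := norm_exp_smul_sub_one_le Y h1c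
  have hCD : ‖E - 1‖ * ‖E' - 1‖ ≤ c * (1 - c) * t ^ 2 * 3 := by
    have he : Real.exp (c * t) * Real.exp ((1 - c) * t) = Real.exp t := by
      rw [← Real.exp_add]; ring_nf
    have het : Real.exp t ≤ 3 := (Real.exp_le_exp.2 hY).trans (by have := Real.exp_one_lt_d9; linarith)
    calc ‖E - 1‖ * ‖E' - 1‖ ≤ (c * t * Real.exp (c * t)) * ((1 - c) * t * Real.exp ((1 - c) * t)) :=
          mul_le_mul hC hD (norm_nonneg _) (by positivity)
      _ = c * (1 - c) * t ^ 2 * Real.exp t := by rw [← he]; ring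
      _ ≤ c * (1 - c) * t ^ 2 * 3 := by gcongr
  rw [key]
  calc ‖((1 - c : ℝ) : ℂ) • (E - 1 - (c : ℂ) • Y) -
          (c : ℂ) • ((E - 1) * (E' - 1) + (E' - 1 - ((1 - c : ℝ) : ℂ) • Y))‖
      ≤ ‖((1 - c : ℝ) : ℂ) • (E - 1 - (c : ℂ) • Y)‖ +
          ‖(c : ℂ) • ((E - 1) * (E' - 1) + (E' - 1 - ((1 - c : ℝ) : ℂ) • Y))‖ := norm_sub_le _ _
    _ = (1 - c) * ‖E - 1 - (c : ℂ) • Y‖ + c * ‖(E - 1) * (E' - 1) + (E' - 1 - ((1 - c : ℝ) : ℂ) • Y)‖ := by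
          rw [norm_real_smul h1c, norm_real_smul hc0]
    _ ≤ (1 - c) * ‖E - 1 - (c : ℂ) • Y‖ + c * (‖E - 1‖ * ‖E' - 1‖ + ‖E' - 1 - ((1 - c : ℝ) : ℂ) • Y‖) := by
          gcongr
          exact (norm_add_le _ _).trans (add_le_add (norm_mul_le _ _) le_rfl)
    _ ≤ (1 - c) * (c * t) ^ 2 + c * (c * (1 - c) * t ^ 2 * 3 + ((1 - c) * t) ^ 2) := by gcongr
    _ = (c * (1 - c)) * t ^ 2 * (1 + 3 * c) := by ring
    _ ≤ 4 * (c * (1 - c)) * ‖Y‖ ^ 2 := by rw [ht]; nlinarith [mul_nonneg (mul_nonneg hc0 h1c) (sq_nonneg t)]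

/-- the list of generators scaled by a real `c`: `Y_i ↦ c·Y_i`. [folklore] -/
def scale (c : ℝ) (l : List A) : List A := l.map fun Y => (c : ℂ) • Y

/-- `Σ_i ‖Y_i‖`. [folklore] -/
def normSum (l : List A) : ℝ := (l.map fun Y => ‖Y‖).sum

/-- the word of exponentials `exp Y₁ ⋯ exp Y_ℓ` (the plaquette holonomy of the letters). [folklore] -/
def wordExp (l : List A) : A := (l.map exp).prod

omit [NormedAlgebra ℂ A] [CompleteSpace A] in
/-- `normSum ≥ 0`. [folklore] -/
theorem normSum_nonneg (l : List A) : 0 ≤ normSum l :=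
  List.sum_nonneg (by intro x hx; obtain ⟨Y, -, rfl⟩ := List.mem_map.1 hx; exact norm_nonneg _)

omit [NormedAlgebra ℂ A] [CompleteSpace A] in
/-- `normSum [] = 0`. [folklore] -/
@[simp] theorem normSum_nil : normSum ([] : List A) = 0 := by simp [normSum]

omit [NormedAlgebra ℂ A] [CompleteSpace A] in
/-- `normSum (Y :: l) = ‖Y‖ + normSum l`. [folklore] -/
@[simp] theorem normSum_cons (Y : A) (l : List A) : normSum (Y :: l) = ‖Y‖ + normSum l := by simp [normSum]

omit [CompleteSpace A] in
/-- `scale c [] = []`. [folklore] -/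
@[simp] theorem scale_nil (c : ℝ) : scale c ([] : List A) = [] := rfl

omit [CompleteSpace A] in
/-- `scale c (Y :: l) = (c·Y) :: scale c l`. [folklore] -/
@[simp] theorem scale_cons (c : ℝ) (Y : A) (l : List A) : scale c (Y :: l) = ((c : ℂ) • Y) :: scale c l := rfl

omit [CompleteSpace A] in
/-- scaling by `1` does nothing. [folklore] -/
@[simp] theorem scale_one (l : List A) : scale 1 l = l := by simp [scale]

omit [CompleteSpace A] in
/-- `normSum (scale c l) = c · normSum l` for `c ≥ 0`. [folklore] -/
theorem normSum_scale {c : ℝ} (hc0 : 0 ≤ c) (l : List A) : normSum (scale c l) = c * normSum l := by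
  induction l with
  | nil => simp
  | cons Y l ih => rw [scale_cons, normSum_cons, normSum_cons, ih, norm_real_smul hc0]; ring

omit [NormedAlgebra ℂ A] [CompleteSpace A] in
/-- the empty word is `1`. [folklore] -/
@[simp] theorem wordExp_nil : wordExp ([] : List A) = 1 := by simp [wordExp]

omit [NormedAlgebra ℂ A] [CompleteSpace A] in
/-- `wordExp (Y :: l) = exp Y · wordExp l`. [folklore] -/
@[simp] theorem wordExp_cons (Y : A) (l : List A) : wordExp (Y :: l) = exp Y * wordExp l := by simp [wordExp]

/-- `‖exp Y₁ ⋯ exp Y_ℓ − 1‖ ≤ e^{Σ‖Y_i‖} − 1` (the lineage's `norm_listProd_exp_sub_one_le`). [folklore] -/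
theorem norm_wordExp_sub_one_le (l : List A) : ‖wordExp l - 1‖ ≤ Real.exp (normSum l) - 1 :=
  norm_listProd_exp_sub_one_le l

/-- `‖exp Y₁ ⋯ exp Y_ℓ − 1‖ ≤ 3 Σ‖Y_i‖` when `Σ‖Y_i‖ ≤ 1`. [folklore] -/
theorem norm_wordExp_sub_one_le_three_mul (l : List A) (hs : normSum l ≤ 1) :
    ‖wordExp l - 1‖ ≤ 3 * normSum l :=
  (norm_wordExp_sub_one_le l).trans ((exp_sub_one_le_pair (normSum_nonneg l)).2 hs)

variable [NormOneClass A]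

/-- `‖exp Y₁ ⋯ exp Y_ℓ‖ ≤ e^{Σ‖Y_i‖}` (`‖1‖ = 1`). [folklore] -/
theorem norm_wordExp_le (l : List A) : ‖wordExp l‖ ≤ Real.exp (normSum l) := by
  have h := norm_wordExp_sub_one_le l
  calc ‖wordExp l‖ = ‖(wordExp l - 1) + 1‖ := by rw [sub_add_cancel]
    _ ≤ ‖wordExp l - 1‖ + ‖(1 : A)‖ := norm_add_le _ _
    _ ≤ (Real.exp (normSum l) - 1) + 1 := by rw [norm_one]; gcongr
    _ = Real.exp (normSum l) := by ring

/-- `‖exp(cY)‖ ≤ e^{c‖Y‖}` for `c ≥ 0`. [folklore] -/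
theorem norm_exp_smul_le (Y : A) {c : ℝ} (hc0 : 0 ≤ c) : ‖exp ((c : ℂ) • Y)‖ ≤ Real.exp (c * ‖Y‖) := by
  have h := norm_wordExp_le [(c : ℂ) • Y]
  rw [wordExp_cons, wordExp_nil, mul_one, normSum_cons, normSum_nil, add_zero, norm_real_smul hc0] at h
  exact h

/-- **(I2) THE TWO-POINT INTERPOLATION BOUND FOR A WORD OF EXPONENTIALS.**  For generators with `s = Σ‖Y_i‖ ≤ 1` and
`0 ≤ c ≤ 1`, the scaled word `h(c) = exp(cY₁) ⋯ exp(cY_ℓ) − 1` satisfies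
`‖h(c) − c·h(1)‖ ≤ 4·c(1−c)·s²·e^{2s}`: non-commutative, by induction on the word with the exact identity
`E Q − 1 − c(E₁Q₁ − 1) = [E − 1 − c(E₁ − 1)] + E·[Q − 1 − c(Q₁ − 1)] + c·(E − E₁)(Q₁ − 1)`. [folklore] -/
theorem norm_wordExp_interp_le : ∀ (l : List A) {c : ℝ}, 0 ≤ c → c ≤ 1 → normSum l ≤ 1 →
    ‖wordExp (scale c l) - 1 - (c : ℂ) • (wordExp l - 1)‖ ≤
      4 * (c * (1 - c)) * normSum l ^ 2 * Real.exp (2 * normSum l)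
  | [], c, _, _, _ => by simp
  | Y :: l, c, hc0, hc1, hs => by
    rw [normSum_cons] at hs
    have ht0 : 0 ≤ ‖Y‖ := norm_nonneg _
    have hσ0 : 0 ≤ normSum l := normSum_nonneg l
    have h1c : 0 ≤ 1 - c := by linarith
    have hY1 : ‖Y‖ ≤ 1 := by linarith
    have hσ1 : normSum l ≤ 1 := by linarith
    have ih := norm_wordExp_interp_le l hc0 hc1 hσ1
    set t := ‖Y‖ with ht
    set σ := normSum l with hσ
    set E := exp ((c : ℂ) • Y) with hE
    set Q := wordExp (scale c l) with hQ
    set Q₁ := wordExp l with hQ₁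
    rw [scale_cons, wordExp_cons, wordExp_cons, normSum_cons, ← hE, ← hQ, ← hQ₁, ← ht, ← hσ]
    have key : E * Q - 1 - (c : ℂ) • (exp Y * Q₁ - 1) =
        (E - 1 - (c : ℂ) • (exp Y - 1)) + E * (Q - 1 - (c : ℂ) • (Q₁ - 1)) +
          (c : ℂ) • ((E - exp Y) * (Q₁ - 1)) := by
      simp only [mul_sub, sub_mul, mul_one, smul_sub, mul_smul_comm]
      module
    -- the pieces
    have hI1 : ‖E - 1 - (c : ℂ) • (exp Y - 1)‖ ≤ 4 * (c * (1 - c)) * t ^ 2 := norm_exp_interp_le Y hc0 hc1 hY1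
    have hEn : ‖E‖ ≤ Real.exp (c * t) := norm_exp_smul_le Y hc0
    have hEE₁ : ‖E - exp Y‖ ≤ (1 - c) * t * Real.exp t := by
      have hsplit : exp Y = E * exp (((1 - c : ℝ) : ℂ) • Y) :=
        exp_eq_exp_smul_mul_exp_smul Y (by ring : c + (1 - c) = 1)
      have e1 : E - exp Y = -(E * (exp (((1 - c : ℝ) : ℂ) • Y) - 1)) := by rw [hsplit]; noncomm_ring
      rw [e1, norm_neg]
      calc ‖E * (exp (((1 - c : ℝ) : ℂ) • Y) - 1)‖ ≤ ‖E‖ * ‖exp (((1 - c : ℝ) : ℂ) • Y) - 1‖ := norm_mul_le _ _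
        _ ≤ Real.exp (c * t) * ((1 - c) * t * Real.exp ((1 - c) * t)) :=
            mul_le_mul hEn (norm_exp_smul_sub_one_le Y h1c) (norm_nonneg _) (Real.exp_pos _).le
        _ = (1 - c) * t * Real.exp t := by
            rw [show Real.exp t = Real.exp (c * t) * Real.exp ((1 - c) * t) by rw [← Real.exp_add]; ring_nf]
            ring
    have hQ₁n : ‖Q₁ - 1‖ ≤ σ * Real.exp σ :=
      (norm_wordExp_sub_one_le l).trans (exp_sub_one_le_pair hσ0).1
    -- exponential comparisons against M = e^{2(t+σ)}
    set M := Real.exp (2 * (t + σ)) with hM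
    have hM1 : 1 ≤ M := Real.one_le_exp (by positivity)
    have hM2 : Real.exp (c * t) * Real.exp (2 * σ) ≤ M := by
      rw [hM, ← Real.exp_add]; exact Real.exp_le_exp.2 (by nlinarith)
    have hM3 : Real.exp t * Real.exp σ ≤ M := by
      rw [hM, ← Real.exp_add]; exact Real.exp_le_exp.2 (by nlinarith)
    have hcc : 0 ≤ c * (1 - c) := mul_nonneg hc0 h1c
    rw [key]
    calc ‖(E - 1 - (c : ℂ) • (exp Y - 1)) + E * (Q - 1 - (c : ℂ) • (Q₁ - 1)) +
            (c : ℂ) • ((E - exp Y) * (Q₁ - 1))‖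
        ≤ ‖E - 1 - (c : ℂ) • (exp Y - 1)‖ + ‖E * (Q - 1 - (c : ℂ) • (Q₁ - 1))‖ +
            ‖(c : ℂ) • ((E - exp Y) * (Q₁ - 1))‖ := norm_add₃_le
      _ ≤ 4 * (c * (1 - c)) * t ^ 2 + ‖E‖ * ‖Q - 1 - (c : ℂ) • (Q₁ - 1)‖ + c * (‖E - exp Y‖ * ‖Q₁ - 1‖) := by
            rw [norm_real_smul hc0]
            gcongr
            · exact norm_mul_le _ _
            · exact norm_mul_le _ _
      _ ≤ 4 * (c * (1 - c)) * t ^ 2 + Real.exp (c * t) * (4 * (c * (1 - c)) * σ ^ 2 * Real.exp (2 * σ)) +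
            c * (((1 - c) * t * Real.exp t) * (σ * Real.exp σ)) := by
            gcongr
      _ = (c * (1 - c)) * (4 * t ^ 2 * 1 + 4 * σ ^ 2 * (Real.exp (c * t) * Real.exp (2 * σ)) +
            t * σ * (Real.exp t * Real.exp σ)) := by ring
      _ ≤ (c * (1 - c)) * (4 * t ^ 2 * M + 4 * σ ^ 2 * M + t * σ * M) := by
            gcongr
      _ ≤ 4 * (c * (1 - c)) * (t + σ) ^ 2 * M := by nlinarith [mul_nonneg (mul_nonneg ht0 hσ0) (le_trans zero_le_one hM1)]

/-- consequence: the scaled word against the chord, `‖h(c)‖ ≤ c‖h(1)‖ + 4c(1−c)s²e^{2s}`. [folklore] -/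
theorem norm_wordExp_scale_sub_one_le (l : List A) {c : ℝ} (hc0 : 0 ≤ c) (hc1 : c ≤ 1) (hs : normSum l ≤ 1) :
    ‖wordExp (scale c l) - 1‖ ≤
      c * ‖wordExp l - 1‖ + 4 * (c * (1 - c)) * normSum l ^ 2 * Real.exp (2 * normSum l) := by
  have h := norm_wordExp_interp_le l hc0 hc1 hs
  calc ‖wordExp (scale c l) - 1‖
      = ‖(c : ℂ) • (wordExp l - 1) + (wordExp (scale c l) - 1 - (c : ℂ) • (wordExp l - 1))‖ := by
        congr 1; abel
    _ ≤ ‖(c : ℂ) • (wordExp l - 1)‖ + ‖wordExp (scale c l) - 1 - (c : ℂ) • (wordExp l - 1)‖ := norm_add_le _ _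
    _ ≤ _ := by rw [norm_real_smul hc0]; gcongr

end Interp

/-! ## §3 (S-i)₀ — the LEVEL-0 CORE MAP: one contraction of the generators sends every sub-threshold word below
`θ(1−ρ)`, uniformly over the plaquettes, with NO transversal / degenerate split -/

section CoreMap

variable {A : Type*} [NormedRing A] [NormedAlgebra ℂ A] [CompleteSpace A] [NormOneClass A]

/-- THE ADMISSIBLE DEPTH: `c = 1 − ρ/(1−δ)` satisfies `c·(1 + δ(1−c)) ≤ 1 − ρ` (`0 ≤ δ < 1`, `ρ ≥ 0`). [folklore] -/
theorem depth_admissible {δ ρ : ℝ} (hδ0 : 0 ≤ δ) (hδ : δ < 1) (hρ0 : 0 ≤ ρ) :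
    (1 - ρ / (1 - δ)) * (1 + δ * (1 - (1 - ρ / (1 - δ)))) ≤ 1 - ρ := by
  have h1δ : 0 < 1 - δ := by linarith
  set ρ' := ρ / (1 - δ) with hρ'
  have hρρ' : ρ = ρ' * (1 - δ) := by rw [hρ']; field_simp
  have hρ'0 : 0 ≤ ρ' := div_nonneg hρ0 h1δ.le
  rw [hρρ']
  nlinarith [mul_nonneg hδ0 (sq_nonneg ρ')]

/-- **(S-i)₀ FOR ONE WORD.**  If `‖exp Y₁ ⋯ exp Y_ℓ − 1‖ < θ` with `s = Σ‖Y_i‖ ≤ 1` and the interpolation constant is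
small against the threshold, `4s²e^{2s} ≤ δ·θ` (THE LEVEL-0 SMALLNESS (SM)₀), then at any depth `0 < c ≤ 1` with
`c(1 + δ(1−c)) ≤ 1 − ρ` the contracted word is read below `θ(1−ρ)`:
`‖exp(cY₁) ⋯ exp(cY_ℓ) − 1‖ < θ(1−ρ)`.  [folklore] -/
theorem coreMap_word (l : List A) {c θ δ ρ : ℝ} (hc0 : 0 < c) (hc1 : c ≤ 1) (hs : normSum l ≤ 1)
    (hθ : 0 < θ) (hK : 4 * normSum l ^ 2 * Real.exp (2 * normSum l) ≤ δ * θ)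
    (hcρ : c * (1 + δ * (1 - c)) ≤ 1 - ρ) (h1 : ‖wordExp l - 1‖ < θ) :
    ‖wordExp (scale c l) - 1‖ < θ * (1 - ρ) := by
  have h := norm_wordExp_scale_sub_one_le l hc0.le hc1 hs
  have h1c : 0 ≤ 1 - c := by linarith
  have hlt : c * ‖wordExp l - 1‖ + 4 * (c * (1 - c)) * normSum l ^ 2 * Real.exp (2 * normSum l) <
      c * θ + c * (1 - c) * (δ * θ) := by
    have h2 : 4 * (c * (1 - c)) * normSum l ^ 2 * Real.exp (2 * normSum l) ≤ c * (1 - c) * (δ * θ) := by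
      have := mul_le_mul_of_nonneg_left hK (mul_nonneg hc0.le h1c)
      linarith
    have h3 : c * ‖wordExp l - 1‖ < c * θ := mul_lt_mul_of_pos_left h1 hc0
    linarith
  calc ‖wordExp (scale c l) - 1‖ < c * θ + c * (1 - c) * (δ * θ) := h.trans_lt hlt
    _ = θ * (c * (1 + δ * (1 - c))) := by ring
    _ ≤ θ * (1 - ρ) := mul_le_mul_of_nonneg_left hcρ hθ.le

/-- **(S-i)₀ FOR THE CLASSIFIER `u = max_p ‖hol_p − 1‖`** over a non-empty finite family of plaquette words: every
word below `θ` ⇒ every contracted word below `θ(1−ρ)` — the max is taken AFTER the bound, so degenerate plaquettes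
(small linear part) need no separate treatment. [folklore] -/
theorem coreMap_sup {ι : Type*} {Ps : Finset ι} (hPs : Ps.Nonempty) (L : ι → List A) {c θ δ ρ : ℝ}
    (hc0 : 0 < c) (hc1 : c ≤ 1) (hs : ∀ p ∈ Ps, normSum (L p) ≤ 1) (hθ : 0 < θ)
    (hK : ∀ p ∈ Ps, 4 * normSum (L p) ^ 2 * Real.exp (2 * normSum (L p)) ≤ δ * θ)
    (hcρ : c * (1 + δ * (1 - c)) ≤ 1 - ρ) (h1 : Ps.sup' hPs (fun p => ‖wordExp (L p) - 1‖) < θ) :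
    Ps.sup' hPs (fun p => ‖wordExp (scale c (L p)) - 1‖) < θ * (1 - ρ) := by
  rw [Finset.sup'_lt_iff] at h1 ⊢
  exact fun p hp => coreMap_word (L p) hc0 hc1 (hs p hp) hθ (hK p hp) hcρ (h1 p hp)

/-- the uniform form of (SM)₀: a common bound `s̄ ≥ s_p` with `4s̄²e^{2s̄} ≤ δθ` serves every plaquette. [folklore] -/
theorem interpConst_mono {s s' : ℝ} (hs0 : 0 ≤ s) (hss' : s ≤ s') :
    4 * s ^ 2 * Real.exp (2 * s) ≤ 4 * s' ^ 2 * Real.exp (2 * s') := by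
  gcongr

end CoreMap

end Summit.QuantumFields.BalabanUV.T4Continuum.ShellMeasureWilsonWords
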